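import Literature.Geometry.Kaehler.MilnorSymbolCocycle
import Literature.NumberTheory.Transcendental.FormsAlgebraWedgeAssocProofs
import Literature.LinearAlgebra.Alternating.WedgeOneWedgeCalculus
import HarnessLib

/-!
# Descent of the symbol form to `K^M_p` in EVERY weight: `∧^p dlog` kills the naive Milnor relations

Theorems file of route `MilnorKExponential` of the Hodge summit, crux `SymbolLiftR`
(stmt-HodgeConjecture-18702: every rational `(q+1,q+1)` class on a smooth projective complex
`n`-fold, `q + 1 ≤ n`, is a Milnor SYMBOL class of weight `q + 1`), line `lefschetz-fold`, kernel
`stub_primitiveLiftExists` (LIFT_p for primitive rational `(p,p)` classes, `2 ≤ p ≤ n/2`).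

Every constructive attack on the kernel (the Appell–Humbert line of the abelian sector, the
`Alg ⊆ L` typing item, the isogeny-weight line) produces a Čech cocycle `σ` of Milnor symbols MODULO
THE NAIVE RELATIONS and must then transgress its symbol forms `w_J = Σ n · dlog f₁ ∧ ⋯ ∧ dlog f_p`
through the Čech–de Rham zig-zag; the zig-zag is solvable only if `δw = 0` on the nose on each
`U_{J'}`, i.e. only if the symbol form of every naive Milnor relation of weight `p` VANISHES at the
points of the open set over which the relation is taken. The tree
(`Literature.Geometry.Kaehler.MilnorSymbolCocycle`) proves this descent in weights `1` and `2` only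
(`symbolForm_apply_eq_zero_of_mem_milnorRel_one/_two`); the kernel lives in weights `≥ 2` on
`n`-folds with `n ≥ 4`, where the zig-zag runs through weights up to `n/2 ≥ 2` and the cup/fold
through all weights. This file proves the descent in every weight:

* `dlogWedge_wedge_dlog_apply_eq_zero` — `(dlog f₁ ∧ ⋯ ∧ dlog f_p) ∧ dlog fᵢ = 0` pointwise
  (a repeated covector kills the iterated wedge: associativity and graded commutativity of the
  shuffle wedge, Warner 2.6, proved in the tree as `WedgeAssoc_holds` / the `(1,1)` shuffle formula);
* `dlogWedge_apply_eq_zero_of_dlog_eq_smul` — the iterated wedge vanishes at `x` as soon as two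
  distinct slots have proportional `dlog`'s at `x`;
* `dlogWedge_apply_eq_zero_of_add_eq_one` — **the Steinberg relation in every weight**: if
  `fᵢ + fⱼ = 1` near `x` (`i ≠ j`) then `dlog f₁ ∧ ⋯ ∧ dlog f_p = 0` at `x` (`d fⱼ = -d fᵢ`, so
  `dlog fⱼ` is a pointwise multiple of `dlog fᵢ`);
* `symbolForm_apply_eq_zero_of_mem_milnorRel` — **the symbol form of every naive Milnor relation
  of weight `p` over an open `W` vanishes at the points of `W`** (all three generating families:
  pointwise agreement and multilinearity by the tree's `symbolForm_apply_eq_zero_of_generator`,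
  Steinberg by the above), i.e. `∧^p dlog : ℤ[good tuples]/milnorRel → Ω^p` is well defined on the
  presheaf level in every weight (Esnault–Viehweg (1988) §7, Green–Griffiths (2005) (6.37));
* `symbolForm_symbolδ_apply_eq_zero` — hence the symbol forms of a Milnor symbol cocycle are
  `δ`-CLOSED ON THE NOSE on every `U_{J'}` (the input of the Čech–de Rham zig-zag).

References: F. W. Warner, *Foundations of Differentiable Manifolds and Lie Groups* (1983), 2.6;
H. Esnault, E. Viehweg, *Deligne–Beilinson cohomology* (1988), §7; M. Green, P. Griffiths, *On the
Tangent Space to the Space of Algebraic Cycles on a Smooth Algebraic Variety* (2005), §6.3;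
H. Esnault, *A note on the cycle map*, J. reine angew. Math. 411 (1990), §3.
-/

noncomputable section

-- The mandated namespace repeats `HodgeConjecture` (single-conjunct summit).
set_option linter.dupNamespace false
-- `TangentSpace 𝓘(ℝ, E) x = E` is an abuse of definitional equality; let `isDefEq` unfold it.
set_option backward.isDefEq.respectTransparency false

open scoped Manifold Topology ContDiff
open Function Filter

namespace Summit.HodgeConjecture.HodgeConjecture.Theorems.SymbolLiftR

open Literature.Geometry.Kaehler

/-! ### Pointwise wedge algebra of complex covectors on a real normed space -/

section Pointwise

variable {V : Type*} [NormedAddCommGroup V] [NormedSpace ℝ V]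

/-- **Anticommutativity of complex covectors**: `D' ∧ D = -(D ∧ D')` for complex-valued `1`-forms on
a real normed space (the `(1,1)` shuffle formula `ContinuousAlternatingMap.wedge_apply_one_one`).
[cite: Warner1983, 2.6] -/
theorem wedge_one_one_anticomm (D D' : V [⋀^Fin 1]→L[ℝ] ℂ) : D'.wedge D = -(D.wedge D') := by
  ext v
  rw [ContinuousAlternatingMap.wedge_apply_one_one, ContinuousAlternatingMap.neg_apply,
    ContinuousAlternatingMap.wedge_apply_one_one]
  ring

/-- `α ∧ (-β) = -(α ∧ β)` for the shuffle wedge (bilinearity). [cite: Warner1983, 2.6] -/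
theorem wedge_neg_right' {k l : ℕ} (α : V [⋀^Fin k]→L[ℝ] ℂ) (β : V [⋀^Fin l]→L[ℝ] ℂ) :
    α.wedge (-β) = -(α.wedge β) := by
  have h := ContinuousAlternatingMap.wedge_add_right α β (-β)
  rw [add_neg_cancel, ContinuousAlternatingMap.wedge_zero] at h
  exact (eq_neg_of_add_eq_zero_right h.symm)

/-- **A covector already present kills one more wedge**: if `η ∧ D = 0` then `(η ∧ D') ∧ D = 0`
for covectors `D`, `D'` (`(η ∧ D') ∧ D = η ∧ (D' ∧ D) = -η ∧ (D ∧ D') = -(η ∧ D) ∧ D' = 0`, by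
associativity `WedgeAssoc_holds` and anticommutativity of covectors). [cite: Warner1983, 2.6] -/
theorem wedge_wedge_eq_zero_of_wedge_eq_zero {k : ℕ} (η : V [⋀^Fin k]→L[ℝ] ℂ)
    (D D' : V [⋀^Fin 1]→L[ℝ] ℂ) (h : η.wedge D = 0) : (η.wedge D').wedge D = 0 := by
  -- `η ∧ (D ∧ D') = 0`, transported from `(η ∧ D) ∧ D' = 0 ∧ D' = 0` through associativity
  have h1 : η.wedge (D.wedge D') = 0 := by
    have h2 := ContinuousAlternatingMap.WedgeAssoc_holds ℝ V ℂ η D D'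
    rw [h, ContinuousAlternatingMap.zero_wedge] at h2
    exact (Literature.LinearAlgebra.Alternating.domDomCongr_finCongr_eq_zero_iff _).1 h2.symm
  rw [ContinuousAlternatingMap.WedgeAssoc_holds ℝ V ℂ η D' D, wedge_one_one_anticomm D D',
    wedge_neg_right', h1, neg_zero, Literature.LinearAlgebra.Alternating.domDomCongr_finCongr_zero]

/-- `(η ∧ D) ∧ D = 0` for a covector `D` (`D ∧ D = 0` and associativity). [cite: Warner1983, 2.6] -/
theorem wedge_wedge_self_eq_zero {k : ℕ} (η : V [⋀^Fin k]→L[ℝ] ℂ) (D : V [⋀^Fin 1]→L[ℝ] ℂ) :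
    (η.wedge D).wedge D = 0 := by
  rw [ContinuousAlternatingMap.WedgeAssoc_holds ℝ V ℂ η D D, wedge_self_eq_zero D,
    ContinuousAlternatingMap.wedge_zero, Literature.LinearAlgebra.Alternating.domDomCongr_finCongr_zero]

end Pointwise

/-! ### The iterated wedge `dlog f₁ ∧ ⋯ ∧ dlog f_p` with a repeated or proportional factor -/

section DlogWedge

variable {E : Type*} [NormedAddCommGroup E] [NormedSpace ℂ E]
  {M : Type*} [TopologicalSpace M] [ChartedSpace E M] {p : ℕ}

/-- **`(dlog f₁ ∧ ⋯ ∧ dlog f_p) ∧ dlog fᵢ = 0` at every point**, for every slot `i` of the tuple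
(induction on the weight, peeling the last factor with `dlogWedge_succ`: the last slot by
`D ∧ D = 0`, an earlier slot by passing `dlog fᵢ` through the last factor with a sign).
[cite: Warner1983, 2.6] -/
theorem dlogWedge_wedge_dlog_apply_eq_zero (t : Fin p → M → ℂ) (i : Fin p) (x : M) :
    ((dlogWedge E p t).wedge (dlog E (t i))) x = 0 := by
  induction p with
  | zero => exact i.elim0
  | succ p ih =>
    rw [dlogWedge_succ, MForm.wedge_apply, MForm.wedge_apply]
    induction i using Fin.lastCases with
    | last => exact wedge_wedge_self_eq_zero (V := E) _ _
    | cast j =>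
      refine wedge_wedge_eq_zero_of_wedge_eq_zero (V := E) _ _ _ ?_
      have h := ih (fun k ↦ t (Fin.castSucc k)) j
      rw [MForm.wedge_apply] at h
      exact h

/-- A zero factor kills the iterated wedge: if `dlog fⱼ = 0` at `x` then
`dlog f₁ ∧ ⋯ ∧ dlog f_p = 0` at `x`. [folklore] -/
theorem dlogWedge_apply_eq_zero_of_dlog_eq_zero {t : Fin p → M → ℂ} {x : M} {j : Fin p}
    (h : dlog E (t j) x = 0) : dlogWedge E p t x = 0 := by
  induction p with
  | zero => exact j.elim0
  | succ p ih =>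
    rw [dlogWedge_succ, MForm.wedge_apply]
    induction j using Fin.lastCases with
    | last =>
      rw [h]
      exact ContinuousAlternatingMap.wedge_zero (V := E) _
    | cast j =>
      have h' : dlogWedge E p (fun k ↦ t (Fin.castSucc k)) x = 0 := ih h
      rw [h']
      exact ContinuousAlternatingMap.zero_wedge (V := E) _

/-- **Two proportional factors kill the iterated wedge**: if `dlog fⱼ = c · dlog fᵢ` at `x` for two
distinct slots `i ≠ j` then `dlog f₁ ∧ ⋯ ∧ dlog f_p = 0` at `x` (alternation of the exterior
algebra, Warner 2.6). [cite: Warner1983, 2.6] -/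
theorem dlogWedge_apply_eq_zero_of_dlog_eq_smul {t : Fin p → M → ℂ} {x : M} {i j : Fin p}
    (hij : i ≠ j) {c : ℂ} (h : dlog E (t j) x = c • dlog E (t i) x) : dlogWedge E p t x = 0 := by
  induction p with
  | zero => exact i.elim0
  | succ p ih =>
    by_cases hc : c = 0
    · rw [hc, zero_smul] at h
      exact dlogWedge_apply_eq_zero_of_dlog_eq_zero h
    rw [dlogWedge_succ, MForm.wedge_apply]
    induction j using Fin.lastCases with
    | last =>
      -- the proportional factor is the last one: `W' ∧ (c • Dᵢ) = c • (W' ∧ Dᵢ) = 0`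
      induction i using Fin.lastCases with
      | last => exact absurd rfl hij
      | cast i =>
        rw [h, Literature.LinearAlgebra.Alternating.wedge_smul_right_complex (V := E)]
        have h0 := dlogWedge_wedge_dlog_apply_eq_zero (E := E) (fun k ↦ t (Fin.castSucc k)) i x
        rw [MForm.wedge_apply] at h0
        rw [h0]
        exact smul_zero (A := E [⋀^Fin (p + 1)]→L[ℝ] ℂ) c
    | cast j =>
      induction i using Fin.lastCases with
      | last =>
        -- the reference factor is the last one: `D_last = c⁻¹ • Dⱼ`, `W' ∧ D_last = c⁻¹ • (W' ∧ Dⱼ) = 0`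
        have h' : dlog E (t (Fin.last p)) x = c⁻¹ • dlog E (t (Fin.castSucc j)) x := by
          rw [h, smul_smul, inv_mul_cancel₀ hc, one_smul]
        rw [h', Literature.LinearAlgebra.Alternating.wedge_smul_right_complex (V := E)]
        have h0 := dlogWedge_wedge_dlog_apply_eq_zero (E := E) (fun k ↦ t (Fin.castSucc k)) j x
        rw [MForm.wedge_apply] at h0
        rw [h0]
        exact smul_zero (A := E [⋀^Fin (p + 1)]→L[ℝ] ℂ) c⁻¹
      | cast i =>
        -- both slots are earlier: induction
        have hij' : i ≠ j := fun hh ↦ hij (by rw [hh])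
        have h0 : dlogWedge E p (fun k ↦ t (Fin.castSucc k)) x = 0 := ih hij' h
        rw [h0]
        exact ContinuousAlternatingMap.zero_wedge (V := E) _

/-- **The Steinberg relation in every weight: `dlog f₁ ∧ ⋯ ∧ dlog f_p = 0` at `x` when
`fᵢ + fⱼ = 1` near `x`** for two distinct slots `i ≠ j` (`fᵢ`, `fⱼ` real `C^∞` at `x`, `fᵢ x ≠ 0`):
`dlog fⱼ` is a pointwise multiple of `dlog fᵢ` (`d fⱼ = -d fᵢ`, the tree's
`dlog_eq_smul_dlog_of_add_eq_one`) and proportional factors kill the iterated wedge. This is why the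
symbol map `∧^p dlog` is defined on Milnor `K`-theory (Esnault–Viehweg §7; Green–Griffiths (6.37)).
[cite: EsnaultViehweg1988DB, §7] -/
theorem dlogWedge_apply_eq_zero_of_add_eq_one {t : Fin p → M → ℂ} {x : M} {i j : Fin p}
    (hij : i ≠ j) (hi : ContMDiffAt 𝓘(ℝ, E) 𝓘(ℝ, ℂ) ∞ (t i) x)
    (hj : ContMDiffAt 𝓘(ℝ, E) 𝓘(ℝ, ℂ) ∞ (t j) x) (hx0 : t i x ≠ 0)
    (h : ∀ᶠ y in 𝓝 x, t i y + t j y = 1) : dlogWedge E p t x = 0 :=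
  dlogWedge_apply_eq_zero_of_dlog_eq_smul hij (dlog_eq_smul_dlog_of_add_eq_one hi hj hx0 h)

/-! ### The descent theorem in every weight -/

variable [IsManifold 𝓘(ℝ, E) ∞ M] [FiniteDimensional ℂ E] [IsManifold 𝓘(ℂ, E) ω M]

/-- **The symbol form `∧^p dlog` descends to `K^M_p` in EVERY weight**: on an open subset `W` of a
complex manifold, the symbol form `Σ n · dlog f₁ ∧ ⋯ ∧ dlog f_p` of every naive Milnor relation of
weight `p` over `W` (`milnorRel E W p`: pointwise agreement, multilinearity, Steinberg) VANISHES at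
the points of `W` — relations (a), (b) by locality and the logarithmic Leibniz rule
(`symbolForm_apply_eq_zero_of_generator`), the Steinberg relation `[t]`, `tᵢ + tⱼ = 1` on `W`, by
`dlogWedge_apply_eq_zero_of_add_eq_one`. Hence `∧^p dlog : ℤ[good tuples on W]/milnorRel → Ω^p(W)`
is a well-defined homomorphism of presheaves (Esnault–Viehweg (1988) §7; Green–Griffiths (2005)
(6.37)); the tree had weights `1`, `2` (`…_of_mem_milnorRel_one/_two`). [cite: EsnaultViehweg1988DB, §7] -/
theorem symbolForm_apply_eq_zero_of_mem_milnorRel {W : Set M} (hW : IsOpen W)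
    {s : (Fin p → M → ℂ) →₀ ℤ} (hs : s ∈ milnorRel E W p) {x : M} (hx : x ∈ W) :
    symbolForm E p s x = 0 := by
  induction hs using AddSubgroup.closure_induction with
  | mem s h =>
    rcases h with h | ⟨t, i, j, ht, hij, h, rfl⟩
    · exact symbolForm_apply_eq_zero_of_generator hW hx h
    · -- (c) the Steinberg relation in slots `i ≠ j`
      rw [symbolForm_single, one_smul]
      exact dlogWedge_apply_eq_zero_of_add_eq_one hij
        (contMDiffAt_real_of_mdifferentiableOn_complex (ht i).1 hW hx)
        (contMDiffAt_real_of_mdifferentiableOn_complex (ht j).1 hW hx) ((ht i).2 x hx)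
        (eventually_of_mem (hW.mem_nhds hx) h)
  | zero => rw [symbolForm_zero, Pi.zero_apply]
  | add a b _ _ ha hb => rw [symbolForm_add, Pi.add_apply, ha, hb, add_zero]
  | neg a _ ha => rw [symbolForm_neg, Pi.neg_apply, ha, neg_zero]

/-- **The symbol forms of a Milnor symbol cocycle are `δ`-closed on the nose**: if `σ` is a Čech
`m`-cochain of chains of good tuples on an open cover `U` whose Čech differential lies in the naive
Milnor relations, `(δσ)_{J'} ∈ milnorRel (U_{J'})` (`IsMilnorSymbolCocycle`), then the alternating
sum `Σ_j (-1)^j · symbolForm (σ_{J' ∘ δ_j})` — the Čech differential of the cochain of symbol forms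
`w_J = symbolForm σ_J`, before restriction — vanishes at every point of `U_{J'}`. This is the
hypothesis `δw = 0` under which the Čech–de Rham zig-zag of `w` is solvable (Bott–Tu §8–9).
[cite: EsnaultViehweg1988DB, §7] -/
theorem symbolForm_symbolδ_apply_eq_zero {ι : Type*} {U : ι → Set M} (hU : ∀ i, IsOpen (U i))
    {m : ℕ} {σ : (Fin (m + 1) → ι) → ((Fin p → M → ℂ) →₀ ℤ)} (hσ : IsMilnorSymbolCocycle E U σ)
    (J' : Fin (m + 2) → ι) {x : M} (hx : x ∈ cechSet U J') :
    symbolForm E p (symbolδ σ J') x = 0 :=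
  symbolForm_apply_eq_zero_of_mem_milnorRel (isOpen_cechSet hU J') (hσ.cocycle J') hx

/-- The same, expanded: `Σ_j (-1)^j · (dlog-forms of σ_{J' ∘ succAbove j}) = 0` at the points of
`U_{J'}` (the symbol form is additive, `symbolFormHom`). [cite: EsnaultViehweg1988DB, §7] -/
theorem sum_symbolForm_face_apply_eq_zero {ι : Type*} {U : ι → Set M} (hU : ∀ i, IsOpen (U i))
    {m : ℕ} {σ : (Fin (m + 1) → ι) → ((Fin p → M → ℂ) →₀ ℤ)} (hσ : IsMilnorSymbolCocycle E U σ)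
    (J' : Fin (m + 2) → ι) {x : M} (hx : x ∈ cechSet U J') :
    (∑ j : Fin (m + 2), ((-1 : ℤ) ^ (j : ℕ)) • symbolForm E p (σ (J' ∘ Fin.succAbove j))) x = 0 := by
  have h := symbolForm_symbolδ_apply_eq_zero hU hσ J' hx
  rw [symbolδ, ← symbolFormHom_apply, map_sum] at h
  simpa only [map_zsmul, symbolFormHom_apply] using h

end DlogWedge

/-- STUB `stub_symbolForm_apply_eq_zero_of_mem_milnorRel` (helper sub-goal registered on
stmt-HodgeConjecture-18702 for the kernel `stub_primitiveLiftExists`: descent of the symbol form in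
every weight, the `δw = 0` input of every zig-zag a constructive proof of the kernel must solve):
`symbolForm_apply_eq_zero_of_mem_milnorRel`, stated closed. [cite: EsnaultViehweg1988DB, §7] -/
theorem stub_symbolForm_apply_eq_zero_of_mem_milnorRel : ∀ {E : Type*} [NormedAddCommGroup E] [NormedSpace ℂ E] {M : Type*} [TopologicalSpace M] [ChartedSpace E M] [IsManifold 𝓘(ℝ, E) ∞ M] [FiniteDimensional ℂ E] [IsManifold 𝓘(ℂ, E) ω M] {p : ℕ} {W : Set M}, IsOpen W → ∀ {s : (Fin p → M → ℂ) →₀ ℤ}, s ∈ milnorRel E W p → ∀ {x : M}, x ∈ W → symbolForm E p s x = 0 :=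
  fun hW _ hs _ hx ↦ symbolForm_apply_eq_zero_of_mem_milnorRel hW hs hx

end Summit.HodgeConjecture.HodgeConjecture.Theorems.SymbolLiftR

end
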